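import Mathlib
import Summits.Ventures.HodgeRepro2.LevelInvariantsCount
import Summits.Ventures.HodgeRepro2.T5DixmierSchur
import Summits.Ventures.HodgeRepro2.T5SchurRepresentation
import Summits.Ventures.HodgeRepro2.T5VanDantzig

/-!
# Central character and level: Prop. B5.3(e) with the scalar supplied by Schur

Blind cell `pub-hodge-repro2`, seat p8 (gen 5), Tier-5 kernel support.  Tier-4 B5's
Prop. B5.3(e) (route/T4-B5-p8.md; kernel form `LevelInvariantsCount.central_character_eq_one`,
p388821) says: if a central element `z` lying in the level `K'` acts on `ρ` by the scalar `χ(z)`,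
then `χ(z) = 1` as soon as `ρ^{K'} ≠ 0` (and `ρ^{K'} = 0` otherwise).  There the scalar action was a
HYPOTHESIS («`z` acts by the scalar `χ(z)` — the printed App. D.1 Step 3»).  Gen 5 supplies it:
for an IRREDUCIBLE representation the central character exists
(`T5SchurRepresentation.centralCharacter`, Dixmier route; `T5VanDantzig` for p-adic groups).
This file composes the two:

* `centralCharacter_eq_one_of_invariants_ne_bot` — irreducible `ρ` of countable dimension over an
  uncountable algebraically closed field, `z ∈ Z(G) ∩ K'`, `ρ^{K'} ≠ 0` ⇒ `χ_ρ(z) = 1`;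
* `invariants_eq_bot_of_centralCharacter_ne_one` — the contrapositive (`χ_ρ(z) ≠ 1` ⇒ `ρ^{K'} = 0`);
* the p-adic form with admissibility in place of countable dimension
  (`centralCharacter_eq_one_of_invariants_ne_bot_padic`), over `ℂ`.

In B5: `ρ = ω(μ, ε, χ)` at a level `K'` containing a central `z`; the printed «`χ(z)`» is the
value of `centralCharacter` (prose: the identification of the two characters).

README §8(d): uses an L-value-free non-vanishing device: NO.
-/

namespace Summit.Ventures.HodgeRepro2.T5CentralCharacterLevel

open Cardinal
open Summit.Ventures.HodgeRepro2.LevelPositivity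
open Summit.Ventures.HodgeRepro2.T5SchurRepresentation
open Summit.Ventures.HodgeRepro2.T5DixmierSchur

variable {G : Type*} [Group G] {k V : Type*} [Field k] [AddCommGroup V] [Module k V]
  (ρ : Representation k G V)

section Dixmier

variable [IsAlgClosed k] (hk : ℵ₀ < #k) [IsSimpleModule (MonoidAlgebra k G) ρ.asModule]
  (hV : Module.rank k V ≤ ℵ₀)

/-- **Prop. B5.3(e) with Schur.** For an irreducible representation of countable dimension over
an uncountable algebraically closed field and a central `z ∈ K'`: if `ρ^{K'} ≠ 0` then the central
character takes the value `1` at `z`. -/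
theorem centralCharacter_eq_one_of_invariants_ne_bot (K' : Subgroup G) (z : Subgroup.center G)
    (hz : (z : G) ∈ K') (hne : invariants ρ K' ≠ ⊥) : centralCharacter ρ hk hV z = 1 := by
  obtain ⟨w, hw, hw0⟩ := (Submodule.ne_bot_iff _).mp hne
  exact central_character_eq_one ρ K' hz (centralCharacter_spec ρ hk hV z) hw hw0

/-- **Prop. B5.3(e), contrapositive.** If the central character is non-trivial at a central
`z ∈ K'`, then `ρ^{K'} = 0`. -/
theorem invariants_eq_bot_of_centralCharacter_ne_one (K' : Subgroup G) (z : Subgroup.center G)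
    (hz : (z : G) ∈ K') (hne : centralCharacter ρ hk hV z ≠ 1) : invariants ρ K' = ⊥ :=
  invariants_eq_bot_of_central_character_ne_one ρ K' hz (centralCharacter_spec ρ hk hV z) hne

end Dixmier

section Padic

open Summit.Ventures.HodgeRepro2.T5VanDantzig

variable [TopologicalSpace G] [IsTopologicalGroup G] [LocallyCompactSpace G] [T2Space G]
  [TotallyDisconnectedSpace G] [FirstCountableTopology G] [IsAlgClosed k]
  [IsSimpleModule (MonoidAlgebra k G) ρ.asModule]

/-- **Prop. B5.3(e) for p-adic groups.** For an irreducible smooth admissible representation of a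
first-countable locally compact totally disconnected Hausdorff group and a central `z ∈ K'`: if
`ρ^{K'} ≠ 0` then `z` acts trivially, i.e. the central character is `1` at `z`. -/
theorem centralCharacter_eq_one_of_invariants_ne_bot_padic (hk : ℵ₀ < #k) (hρ : IsSmooth ρ)
    (hadm : ∀ K : Subgroup G, IsOpen (K : Set G) → IsCompact (K : Set G) →
      FiniteDimensional k (invariants ρ K))
    (K' : Subgroup G) (z : Subgroup.center G) (hz : (z : G) ∈ K') (hne : invariants ρ K' ≠ ⊥) :
    centralCharacter ρ hk (rank_le_aleph0_of_admissible ρ hρ hadm) z = 1 :=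
  centralCharacter_eq_one_of_invariants_ne_bot ρ hk (rank_le_aleph0_of_admissible ρ hρ hadm) K' z
    hz hne

/-- The same, pointwise: `ρ z v = v` for all `v` once `ρ^{K'} ≠ 0`. -/
theorem apply_eq_self_of_invariants_ne_bot_padic (hk : ℵ₀ < #k) (hρ : IsSmooth ρ)
    (hadm : ∀ K : Subgroup G, IsOpen (K : Set G) → IsCompact (K : Set G) →
      FiniteDimensional k (invariants ρ K))
    (K' : Subgroup G) (z : Subgroup.center G) (hz : (z : G) ∈ K') (hne : invariants ρ K' ≠ ⊥)
    (v : V) : ρ z v = v := by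
  rw [centralCharacter_spec ρ hk (rank_le_aleph0_of_admissible ρ hρ hadm) z v,
    centralCharacter_eq_one_of_invariants_ne_bot_padic ρ hk hρ hadm K' z hz hne, one_smul]

end Padic

section Complex

open Summit.Ventures.HodgeRepro2.T5VanDantzig

variable {G' : Type*} [Group G'] [TopologicalSpace G'] [IsTopologicalGroup G']
  [LocallyCompactSpace G'] [T2Space G'] [TotallyDisconnectedSpace G'] [FirstCountableTopology G']
  {V' : Type*} [AddCommGroup V'] [Module ℂ V'] (ρ' : Representation ℂ G' V')
  [IsSimpleModule (MonoidAlgebra ℂ G') ρ'.asModule]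

/-- **Prop. B5.3(e) over `ℂ` for p-adic groups**: a central element of the level acts trivially on
an irreducible smooth admissible representation with non-zero level-`K'` invariants. -/
theorem apply_eq_self_of_invariants_ne_bot_complex (hρ : IsSmooth ρ')
    (hadm : ∀ K : Subgroup G', IsOpen (K : Set G') → IsCompact (K : Set G') →
      FiniteDimensional ℂ (invariants ρ' K))
    (K' : Subgroup G') (z : Subgroup.center G') (hz : (z : G') ∈ K') (hne : invariants ρ' K' ≠ ⊥)
    (v : V') : ρ' z v = v :=
  apply_eq_self_of_invariants_ne_bot_padic ρ' aleph0_lt_mk_complex hρ hadm K' z hz hne v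

end Complex

end Summit.Ventures.HodgeRepro2.T5CentralCharacterLevel
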